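import Summits.NavierStokesRegularity.NavierStokesRegularity.Theorems.PerpetualPumpAveragedTypeIBlowupAssemblyTools

/-!
# Crux `PerpetualPump.AveragedTypeIBlowup` (stmt-NavierStokesRegularity-1835), line `Sketch`: the Duhamel restart
# inequality of a majorant of ANY scale, read in the slow time of the front (lead c1 assembly tool)
-/

noncomputable section
set_option linter.dupNamespace false

open Set MeasureTheory Filter Topology intervalIntegral

namespace Summit.NavierStokesRegularity.NavierStokesRegularity.Theorems.PerpetualPumpAveragedTypeIBlowup

/-- **Majorant restart in the front's slow time, general scale.** If `M(t₂) ≤ M(t₁)e^{-θ Rk (t₂−t₁)} +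
Rk ∫_{t₁}^{t₂} e^{-θ Rk (t₂−u)}|G(u)| du` at the real times `tᵢ = t₀ + σᵢ/Rn`, then with the relative rate `κ = Rk/Rn`:
`m(σ₂) ≤ m(σ₁)e^{-θκ(σ₂−σ₁)} + κ∫_{σ₁}^{σ₂} e^{-θκ(σ₂−v)}|G(t₀+v/Rn)| dv`, `m(σ) = M(t₀+σ/Rn)`. [folklore] -/
theorem restart_rescale_mode :
    ∀ {M G : ℝ → ℝ} {t₀ Rn Rk θ σ₁ σ₂ : ℝ}, 0 < Rn →
      M (t₀ + σ₂ / Rn) ≤ M (t₀ + σ₁ / Rn) * Real.exp (-(θ * Rk * ((t₀ + σ₂ / Rn) - (t₀ + σ₁ / Rn)))) +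
        Rk * ∫ u in (t₀ + σ₁ / Rn)..(t₀ + σ₂ / Rn), Real.exp (-(θ * Rk * ((t₀ + σ₂ / Rn) - u))) * |G u| →
      M (t₀ + σ₂ / Rn) ≤ M (t₀ + σ₁ / Rn) * Real.exp (-(θ * (Rk / Rn) * (σ₂ - σ₁))) +
        Rk / Rn * ∫ v in σ₁..σ₂, Real.exp (-(θ * (Rk / Rn) * (σ₂ - v))) * |G (t₀ + v / Rn)| := by
  intro M G t₀ Rn Rk θ σ₁ σ₂ hRn h
  have hR0 : Rn ≠ 0 := hRn.ne'
  have e1 : θ * Rk * ((t₀ + σ₂ / Rn) - (t₀ + σ₁ / Rn)) = θ * (Rk / Rn) * (σ₂ - σ₁) := by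
    field_simp
    ring
  have e2 : Rk * ∫ u in (t₀ + σ₁ / Rn)..(t₀ + σ₂ / Rn), Real.exp (-(θ * Rk * ((t₀ + σ₂ / Rn) - u))) * |G u| =
      Rk / Rn * ∫ v in σ₁..σ₂, Real.exp (-(θ * (Rk / Rn) * (σ₂ - v))) * |G (t₀ + v / Rn)| := by
    have hsub := integral_rescale (fun u' => Real.exp (-(θ * Rk * ((t₀ + σ₂ / Rn) - u'))) * |G u'|) (t₀ := t₀) hR0 σ₁ σ₂
    -- hsub : ∫ u in .., Rn * (…) = ∫ v in σ₁..σ₂, (…)(t₀ + v/Rn)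
    have hL : ∫ u in (t₀ + σ₁ / Rn)..(t₀ + σ₂ / Rn), Real.exp (-(θ * Rk * ((t₀ + σ₂ / Rn) - u))) * |G u| =
        (1 / Rn) * ∫ v in σ₁..σ₂, Real.exp (-(θ * Rk * ((t₀ + σ₂ / Rn) - (t₀ + v / Rn)))) * |G (t₀ + v / Rn)| := by
      rw [← hsub, ← intervalIntegral.integral_const_mul]
      refine intervalIntegral.integral_congr fun u _ => ?_
      field_simp
    rw [hL, ← mul_assoc, show Rk * (1 / Rn) = Rk / Rn by ring]
    congr 1
    refine intervalIntegral.integral_congr fun v _ => ?_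
    have : θ * Rk * ((t₀ + σ₂ / Rn) - (t₀ + v / Rn)) = θ * (Rk / Rn) * (σ₂ - v) := by
      field_simp
      ring
    simp only [this]
  rw [e1, e2] at h
  exact h

end Summit.NavierStokesRegularity.NavierStokesRegularity.Theorems.PerpetualPumpAveragedTypeIBlowup

end
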